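import Summits.QuantumFields.YangMills.Theorems.BalabanUVNodesN15KingModelFullPropagatorL2Local
import Summits.QuantumFields.YangMills.Theorems.BalabanUVNodesN15KingModelFullPropagatorGradRateProfileDecay

/-!
# BalabanUVNodes ∕ N15 — THE KING-MODEL RUNG, CURVED EDITION (PART Π): THE η-RATES OF THE LOCALISED `L²` ENTRIES — NE2-TYPE STATEMENTS FOR [B9]'s
# (3.46) LAYER AT `U ≡ 1`, UNIFORM IN THE SCALE SHIFT `n`: `‖h·(A₀′⁻¹(λ∘π) − (A₀⁻¹λ)∘π)‖_{ℓ²(η′)} ≤ C·|h|_∞·(L^{−γ∕2})^K·e^{−δ|b−b′|}·‖λ‖_{ℓ²(η)}`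
# (the entry `hGλ`), for King's full `A = 0` propagator, UNIFORMLY in `K`, `n`, the volume and the mass
# (Track A, DAG node N15 = NE2; FAN-OUT v1.1 §N15 s3 «KING-MODEL RUNG … + the one-line statement of what the curved case adds»)

HONEST FRAMING.  Count-neutral operator bookkeeping (cell `pub-ymgap`, seat `pub-ymgap-dag-n15-e` g10; `--supports stmt-QuantumFields-20544 --as helper` = K3⁷
`SpineGivenEndpointR13SepCoPH`, WORDS-143).  TEMPLATE LITERATURE, `A = 0`: C. King's scalar U(1)-Higgs MODEL on finite tori ([King1986] (2.13)–(2.17) p. 653,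
Prop. 3.8 (3.71) p. 664, Prop. 3.9 (3.73) p. 665: two-spacing η-rates `L^{−γk}` of kernels; King's pairing «x′ ∈ B^n(x)» p. 664), NOT Bałaban's covariant objects.
The node's NE2 (`T4EtaRate.EtaRateIneq342`) types the η-rate of the four (3.42) SUP entries only; [B9] Thm 3.1 also prints the `L²` layer (3.46)
«`‖hG′λ‖, ‖h∇_UG′λ‖, … ≤ B₀[…]|h|e^{−δ₀d(y,y′)}‖λ‖`».  THIS FILE decides, in the MODEL, the η-RATE of the first localised `L²` entry: the pair operator `λ ↦ A₀′⁻¹(λ∘π) − (A₀⁻¹λ)∘π` (fine run `K + n` levels against the coarse run `K` levels, King's pairing `π = underPtN`) is a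
kernel operator on the η′-lattice applied to `λ∘π` with kernel `N′^{−(d+1)}[G′(x′, y′) − G(πx′, πy′)]` (part S-e's RATE PROFILE with decay); Schur's test (part
Ξ-a) on that profile gives the operator rate `C·θ^K`, and — unlike the Hölder-normed sup entry (3.44), whose rate against the piecewise-constant `λ∘π` is NOT
uniform in `n` — the weighted `ℓ²` norm of `λ∘π` EQUALS that of `λ` (`N′^{−(d+1)}L^{n(d+1)} = N^{−(d+1)}`), so the `L²` layer's rate IS uniform in `n`.  Decided in
the MODEL at `U ≡ 1`; an NE2-TYPE statement for a layer the node's predicate does not type; NOT Bałaban's `G(U)`; NE2⁺ is NOT PRINTED and not proved; NOT a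
node discharge; nothing continuum ∕ ℝ⁴ ∕ OS ∕ mass-gap ∕ Clay.  0 `sorry`, 0 `def`, standard axioms.
* §1 `fineSum_exp_level_le` (`Σ_{y′}e^{−δr′q∕N′} ≤ (4(d+1)N′∕(δq))^{d+1}`), ★ `rateProfile_fineSum_le` (weighted row sums of a rate profile are `≤ A·θ^K`: paired
  levels `θ^KΣ_i t^i`, unpaired levels `Σ_i u^{K+i} ≤ 2u^K ≤ 2θ^K`), `sum_sq_comp_underPtN` (`N′^{−(d+1)}Σ_{y′}(λ(πy′))² = N^{−(d+1)}Σ_yλ(y)²`);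
* §2 ★★ **`fullPropOp_l2_local_rate`** (`0 ≤ γ ≤ 1`) — for cut-offs `h` (`|h| ≤ H_h`, `supp h ⊂ b` on the η′-lattice) and sources `λ` (`supp λ ⊂ b′` on the
  η-lattice): `N′^{−(d+1)}Σ_{x′}(h(x′)·[(A₀′⁻¹(λ∘π))(x′) − (A₀⁻¹λ)(πx′)])² ≤ (C·H_h·θ^K·e^{−δ|b−b′|})²·N^{−(d+1)}Σ_yλ(y)²` (the gradient entry `h∇Gλ`, from
  part S-f's profile with `Λ = L^d`, `t = L^{γ∕2−1}`, is the sequel Π-b).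
WHAT THE CURVED CASE ADDS (one line): the same rates for `G′(U)`'s (3.46) entries over `Reg335` — NOT printed ([B9] prints η-uniformity, never an η-difference).
HONEST SCOPE.  (i) `A = 0`, periodic b.c., odd `L ≥ 3`, cubes `2L^e`, `K, n ≥ 1`, `0 < m² ≤ m₀²`; (ii) King's spelling; weighted `ℓ²` sums `N^{−(d+1)}Σ`;
forward η-differences; King's pairing; (iii) single-block cut-off ∕ source; entry `hGλ` here (the `hG∇*λ` entry against `λ∘π` involves `∇′*(λ∘π)`, a
DIFFERENT source — not treated); (iv) `0 ≤ γ ≤ 1`; (v) not Bałaban's `G(U)`; not a discharge.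
Locators: [Balaban1985BackgroundPropagators] Thm 3.1 (3.46) p. 398; [King1986] (2.13)–(2.17) p. 653, Prop. 3.8 (3.71) p. 664, Prop. 3.9 (3.73) p. 665.
-/

noncomputable section

namespace Summit.QuantumFields.YangMills.BalabanUVNodes.N15KingModelRung.Curved

open Real Finset Matrix
open Literature.MathematicalPhysics.QuantumFieldTheory.Balaban1983to89.B4Sect5Proof (latticeConst)
open Literature.MathematicalPhysics.QuantumFieldTheory.Balaban1983to89.B5Prop11Plancherel (Tor fine unitVec)
open Literature.MathematicalPhysics.QuantumFieldTheory.King1986 (aK aK_pos)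
open Literature.MathematicalPhysics.QuantumFieldTheory.King1986.Torus (fineOp constrainedProp blockOf tdistT tdistT_nonneg tdistT_symm
  tdistT_self tdistT_sumBound)

variable {d : ℕ} (L : ℕ) [NeZero L]

/-! ## §1 Row sums of the rate profiles; the pairing preserves the weighted `ℓ²` norm -/

omit [NeZero L] in
/-- **One level's lattice sum**: for `1 ≤ q ≤ N′` and `0 < δ ≤ 1`, `Σ_{y′}e^{−δ·|x′ − y′|·q∕N′} ≤ (4(d+1)N′∕(δq))^{d+1}` — the tree's `tdistT_sumBound` with part V-b's
explicit constant `latticeConst_le_of_le` at the small rate `δq∕N′ ≤ 1`. [cite: Balaban1983RegularityDecay, §5 (5.7)–(5.8) p.594] -/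
theorem fineSum_exp_level_le (N' : ℕ) [NeZero N'] (M : Fin (d + 1) → ℕ) [∀ μ, NeZero (M μ)] {δ q : ℝ} (hδ0 : 0 < δ) (hδ1 : δ ≤ 1)
    (hq1 : 1 ≤ q) (hqN : q ≤ (N' : ℝ)) (x' : Tor (fine N' M)) :
    ∑ y', Real.exp (-(δ * (tdistT (fine N' M) x' y' * q / (N' : ℝ)))) ≤ (4 * ((d : ℝ) + 1) * (N' : ℝ) / (δ * q)) ^ (d + 1) := by
  have hq0 : 0 < q := by linarith
  have hN0 : 0 < (N' : ℝ) := by linarith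
  set κ : ℝ := δ * q / (N' : ℝ) with hκdef
  have hκ0 : 0 < κ := by positivity
  have hκ1 : κ ≤ ((d + 1 : ℕ) : ℝ) := by
    have h1 : κ ≤ 1 := by
      rw [hκdef, div_le_one hN0]
      calc δ * q ≤ 1 * q := mul_le_mul_of_nonneg_right hδ1 hq0.le
        _ ≤ (N' : ℝ) := by rw [one_mul]; exact hqN
    have h2 : (1 : ℝ) ≤ ((d + 1 : ℕ) : ℝ) := by exact_mod_cast Nat.le_add_left 1 d
    linarith
  have hrw : ∀ y', Real.exp (-(δ * (tdistT (fine N' M) x' y' * q / (N' : ℝ)))) = Real.exp (-(κ * tdistT (fine N' M) x' y')) := fun y' => by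
    rw [hκdef]; congr 1; ring
  rw [Finset.sum_congr rfl fun y' _ => hrw y']
  have h := (tdistT_sumBound (fine N' M) κ hκ0 x').trans (latticeConst_le_of_le (d + 1) (by omega) hκ0 hκ1)
  have he : 4 * ((d + 1 : ℕ) : ℝ) / κ = 4 * ((d : ℝ) + 1) * (N' : ℝ) / (δ * q) := by
    rw [hκdef]; push_cast; field_simp
  rw [he] at h
  exact h

omit [NeZero L] in
/-- ★ **WEIGHTED ROW SUMS OF A RATE PROFILE ARE `≤ A·θ^K`**: on the η′-lattice (`N′ = L^nL^K`), for `0 < δ ≤ 1`, a level weight `Λ ≥ 0` with PAIRED ratio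
`Λφ ≤ L^{d+1}·t` (`0 ≤ t < 1`) and UNPAIRED ratio `2Λ ≤ L^{d+1}`, `Λ ≤ L^{d+1}·θ` (`θ, φ ≥ 0`):
`Σ_{y′}N′^{−(d+1)}·[θ^KΣ_{i<K}(Λφ)^i e^{−δr′L^i∕N′} + Σ_{i<n}Λ^{K+i}e^{−δr′L^{K+i}∕N′}] ≤ (4(d+1)∕δ)^{d+1}·(1∕(1 − t) + 2)·θ^K` — each level's lattice sum is
`(4(d+1)N′∕(δL^j))^{d+1}` (§1), `N′^{−(d+1)}Λ^j(N′∕L^j)^{d+1} = (Λ∕L^{d+1})^j`: the paired levels give `θ^KΣt^i ≤ θ^K∕(1−t)`, the unpaired ones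
`Σ_iu^{K+i} ≤ 2u^K ≤ 2θ^K` (`u = Λ∕L^{d+1} ≤ ½`, `u ≤ θ`). [cite: King1986, Prop. 3.9 (3.73) p.665 (rate per slice), (2.17) p.653] -/
theorem rateProfile_fineSum_le (hL : 2 ≤ L) {K n : ℕ} (N' : ℕ) [NeZero N'] (hN' : N' = L ^ n * L ^ K) (M : Fin (d + 1) → ℕ)
    [∀ μ, NeZero (M μ)] {δ Λ φ θ t : ℝ} (hδ0 : 0 < δ) (hδ1 : δ ≤ 1) (hΛ : 0 ≤ Λ) (hφ : 0 ≤ φ) (hθ : 0 ≤ θ) (ht0 : 0 ≤ t)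
    (ht1 : t < 1) (hpair : Λ * φ ≤ (L : ℝ) ^ (d + 1) * t) (hunp2 : 2 * Λ ≤ (L : ℝ) ^ (d + 1)) (hunpθ : Λ ≤ (L : ℝ) ^ (d + 1) * θ)
    (x' : Tor (fine N' M)) :
    ∑ y', ((N' : ℝ) ^ (d + 1))⁻¹ * (θ ^ K * ∑ i ∈ Finset.range K, (Λ * φ) ^ i
          * Real.exp (-(δ * (tdistT (fine N' M) x' y' * (L : ℝ) ^ i / (N' : ℝ))))
        + ∑ i ∈ Finset.range n, Λ ^ (K + i) * Real.exp (-(δ * (tdistT (fine N' M) x' y' * (L : ℝ) ^ (K + i) / (N' : ℝ)))))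
      ≤ (4 * ((d : ℝ) + 1) / δ) ^ (d + 1) * (1 / (1 - t) + 2) * θ ^ K := by
  have hLr : (2 : ℝ) ≤ L := by exact_mod_cast hL
  have hL0 : (0 : ℝ) < L := by linarith
  have hL1 : (1 : ℝ) ≤ L := by linarith
  have hLd : (0 : ℝ) < (L : ℝ) ^ (d + 1) := by positivity
  have hN'r : (N' : ℝ) = (L : ℝ) ^ n * (L : ℝ) ^ K := by rw [hN']; push_cast; ring
  have hN0 : 0 < (N' : ℝ) := by rw [hN'r]; positivity
  set A : ℝ := (4 * ((d : ℝ) + 1) / δ) ^ (d + 1) with hAdef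
  have hA0 : 0 ≤ A := by positivity
  set c : ℝ := ((N' : ℝ) ^ (d + 1))⁻¹ with hcdef
  have hc0 : 0 ≤ c := by positivity
  -- one level `j` (`L^j ≤ N′`): `c·W·Σ_{y′}e^{…} ≤ A·W·(L^j)^{−(d+1)}`
  have hlev : ∀ (j : ℕ) (W : ℝ), 0 ≤ W → (L : ℝ) ^ j ≤ (N' : ℝ) →
      ∑ y', c * (W * Real.exp (-(δ * (tdistT (fine N' M) x' y' * (L : ℝ) ^ j / (N' : ℝ))))) ≤ A * (W * (((L : ℝ) ^ j) ^ (d + 1))⁻¹) := by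
    intro j W hW hjN
    have hq1 : (1 : ℝ) ≤ (L : ℝ) ^ j := one_le_pow₀ hL1
    have hq0 : (0 : ℝ) < (L : ℝ) ^ j := by positivity
    have hs := fineSum_exp_level_le N' M hδ0 hδ1 hq1 hjN x'
    rw [← Finset.mul_sum, ← Finset.mul_sum]
    have he : c * (4 * ((d : ℝ) + 1) * (N' : ℝ) / (δ * (L : ℝ) ^ j)) ^ (d + 1) = A * (((L : ℝ) ^ j) ^ (d + 1))⁻¹ := by
      rw [hAdef, hcdef]
      have hq : (L : ℝ) ^ j ≠ 0 := hq0.ne'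
      have hN : (N' : ℝ) ≠ 0 := hN0.ne'
      have hδ : δ ≠ 0 := hδ0.ne'
      rw [div_pow, div_pow, mul_pow, mul_pow]
      field_simp
      ring
    calc c * (W * ∑ y', Real.exp (-(δ * (tdistT (fine N' M) x' y' * (L : ℝ) ^ j / (N' : ℝ)))))
        ≤ c * (W * (4 * ((d : ℝ) + 1) * (N' : ℝ) / (δ * (L : ℝ) ^ j)) ^ (d + 1)) :=
          mul_le_mul_of_nonneg_left (mul_le_mul_of_nonneg_left hs hW) hc0
      _ = W * (c * (4 * ((d : ℝ) + 1) * (N' : ℝ) / (δ * (L : ℝ) ^ j)) ^ (d + 1)) := by ring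
      _ = W * (A * (((L : ℝ) ^ j) ^ (d + 1))⁻¹) := by rw [he]
      _ = A * (W * (((L : ℝ) ^ j) ^ (d + 1))⁻¹) := by ring
  -- the paired levels
  have hP : ∑ y', c * (θ ^ K * ∑ i ∈ Finset.range K, (Λ * φ) ^ i
          * Real.exp (-(δ * (tdistT (fine N' M) x' y' * (L : ℝ) ^ i / (N' : ℝ)))))
      ≤ A * θ ^ K * (1 / (1 - t)) := by
    have hexp : ∀ y', c * (θ ^ K * ∑ i ∈ Finset.range K, (Λ * φ) ^ i
          * Real.exp (-(δ * (tdistT (fine N' M) x' y' * (L : ℝ) ^ i / (N' : ℝ)))))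
        = ∑ i ∈ Finset.range K, c * ((θ ^ K * (Λ * φ) ^ i)
          * Real.exp (-(δ * (tdistT (fine N' M) x' y' * (L : ℝ) ^ i / (N' : ℝ))))) := fun y' => by
      rw [Finset.mul_sum, Finset.mul_sum]
      exact Finset.sum_congr rfl fun i _ => by ring
    rw [Finset.sum_congr rfl fun y' _ => hexp y', Finset.sum_comm]
    have hi : ∀ i ∈ Finset.range K, ∑ y', c * ((θ ^ K * (Λ * φ) ^ i)
          * Real.exp (-(δ * (tdistT (fine N' M) x' y' * (L : ℝ) ^ i / (N' : ℝ))))) ≤ A * θ ^ K * t ^ i := by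
      intro i hi
      have hiK : i < K := Finset.mem_range.mp hi
      have hiN : (L : ℝ) ^ i ≤ (N' : ℝ) := by
        rw [hN'r]
        calc (L : ℝ) ^ i ≤ (L : ℝ) ^ K := pow_le_pow_right₀ hL1 hiK.le
          _ ≤ (L : ℝ) ^ n * (L : ℝ) ^ K := le_mul_of_one_le_left (by positivity) (one_le_pow₀ hL1)
      refine (hlev i _ (by positivity) hiN).trans ?_
      -- `(Λφ)^i·(L^i)^{−(d+1)} ≤ t^i`
      have hratio : (Λ * φ) ^ i * (((L : ℝ) ^ i) ^ (d + 1))⁻¹ ≤ t ^ i := by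
        rw [← pow_mul, mul_comm i (d + 1), pow_mul, ← inv_pow, ← mul_pow]
        apply pow_le_pow_left₀ (by positivity)
        rw [← div_eq_mul_inv, div_le_iff₀ hLd]
        linarith
      calc A * (θ ^ K * (Λ * φ) ^ i * (((L : ℝ) ^ i) ^ (d + 1))⁻¹) = A * θ ^ K * ((Λ * φ) ^ i * (((L : ℝ) ^ i) ^ (d + 1))⁻¹) := by ring
        _ ≤ A * θ ^ K * t ^ i := mul_le_mul_of_nonneg_left hratio (by positivity)
    have hgeom : ∑ i ∈ Finset.range K, t ^ i ≤ 1 / (1 - t) := by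
      have h := geom_sum_Ico_le_of_lt_one (m := 0) (n := K) ht0 ht1
      rwa [← Finset.range_eq_Ico, pow_zero] at h
    calc _ ≤ ∑ i ∈ Finset.range K, A * θ ^ K * t ^ i := Finset.sum_le_sum hi
      _ = A * θ ^ K * ∑ i ∈ Finset.range K, t ^ i := by rw [Finset.mul_sum]
      _ ≤ A * θ ^ K * (1 / (1 - t)) := mul_le_mul_of_nonneg_left hgeom (by positivity)
  -- the unpaired levels
  set u : ℝ := Λ / (L : ℝ) ^ (d + 1) with hudef
  have hu0 : 0 ≤ u := by positivity
  have hu2 : u ≤ 2⁻¹ := by rw [hudef, div_le_iff₀ hLd]; linarith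
  have huθ : u ≤ θ := by rw [hudef, div_le_iff₀ hLd]; linarith
  have hU : ∑ y', c * ∑ i ∈ Finset.range n, Λ ^ (K + i) * Real.exp (-(δ * (tdistT (fine N' M) x' y' * (L : ℝ) ^ (K + i) / (N' : ℝ))))
      ≤ A * θ ^ K * 2 := by
    rw [Finset.sum_congr rfl fun y' _ => (Finset.mul_sum _ _ _), Finset.sum_comm]
    have hi : ∀ i ∈ Finset.range n, ∑ y', c * (Λ ^ (K + i)
          * Real.exp (-(δ * (tdistT (fine N' M) x' y' * (L : ℝ) ^ (K + i) / (N' : ℝ))))) ≤ A * (u ^ K * u ^ i) := by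
      intro i hi
      have hin : i < n := Finset.mem_range.mp hi
      have hiN : (L : ℝ) ^ (K + i) ≤ (N' : ℝ) := by
        rw [hN'r, pow_add, mul_comm]
        exact mul_le_mul_of_nonneg_right (pow_le_pow_right₀ hL1 hin.le) (by positivity)
      refine (hlev (K + i) _ (by positivity) hiN).trans (le_of_eq ?_)
      rw [← pow_add, ← pow_mul, mul_comm (K + i) (d + 1), pow_mul, ← inv_pow, ← mul_pow, ← div_eq_mul_inv]
    have hgeom : ∑ i ∈ Finset.range n, u ^ i ≤ 2 := by
      have h := geom_sum_Ico_le_of_lt_one (m := 0) (n := n) hu0 (by linarith)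
      rw [← Finset.range_eq_Ico, pow_zero] at h
      refine h.trans ?_
      rw [div_le_iff₀ (by linarith)]; linarith
    have huK : u ^ K ≤ θ ^ K := pow_le_pow_left₀ hu0 huθ K
    calc _ ≤ ∑ i ∈ Finset.range n, A * (u ^ K * u ^ i) := Finset.sum_le_sum hi
      _ = A * u ^ K * ∑ i ∈ Finset.range n, u ^ i := by rw [Finset.mul_sum]; exact Finset.sum_congr rfl fun i _ => by ring
      _ ≤ A * θ ^ K * 2 := mul_le_mul (mul_le_mul_of_nonneg_left huK hA0) hgeom (Finset.sum_nonneg fun i _ => by positivity)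
          (by positivity)
  rw [Finset.sum_congr rfl fun y' _ => (mul_add _ _ _), Finset.sum_add_distrib]
  calc _ ≤ A * θ ^ K * (1 / (1 - t)) + A * θ ^ K * 2 := add_le_add hP hU
    _ = A * (1 / (1 - t) + 2) * θ ^ K := by ring

/-- **King's pairing preserves the weighted `ℓ²` norm**: `(L^nL^K)^{−(d+1)}Σ_{y′}λ(πy′)² = (L^K)^{−(d+1)}Σ_yλ(y)²` (part P″ `sum_comp_underPtN`: every coarse
point has `(L^n)^{d+1}` fine points over it). [cite: King1986, p.664 (pairing convention)] -/
theorem sum_sq_comp_underPtN (K n : ℕ) (M : Fin (d + 1) → ℕ) [∀ μ, NeZero (M μ)] (lam : Tor (fine (L ^ K) M) → ℝ) :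
    (((L ^ n * L ^ K : ℕ) : ℝ) ^ (d + 1))⁻¹ * ∑ y' : Tor (fine (L ^ n * L ^ K) M), lam (underPtN L K n M y') ^ 2
      = (((L ^ K : ℕ) : ℝ) ^ (d + 1))⁻¹ * ∑ y, lam y ^ 2 := by
  have hL0 : ((L : ℕ) : ℝ) ≠ 0 := by exact_mod_cast NeZero.ne L
  rw [sum_comp_underPtN L K n M (fun y => lam y ^ 2)]
  push_cast
  have h1 : ((L : ℝ) ^ n) ^ (d + 1) ≠ 0 := by positivity
  have h2 : ((L : ℝ) ^ K) ^ (d + 1) ≠ 0 := by positivity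
  field_simp
  ring

/-! ## §2 The η-rates of the localised `L²` entries -/

set_option maxHeartbeats 400000 in
/-- ★★ **THE η-RATE OF THE LOCALISED `L²` ENTRY `hGλ` — AN NE2-TYPE STATEMENT FOR THE (3.46) LAYER, UNIFORM IN `n`.**  For odd `L ≥ 3`, `a > 0`, `m₀² ≥ 0`
and `0 ≤ γ ≤ 1` there are `C, δ > 0` such that for EVERY `K ≥ 1`, `n ≥ 1` (`N = L^K`, `N′ = L^nL^K`), cube `2L^e`, mass `0 < m² ≤ m₀²`, every cut-off `h` on the
η′-lattice (`|h| ≤ H_h`, `supp h ⊂` unit block `b`) and every source `λ` on the η-lattice (`supp λ ⊂` unit block `b′`):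
`N′^{−(d+1)}Σ_{x′}(h(x′)·[(A₀′⁻¹(λ∘π))(x′) − (A₀⁻¹λ)(πx′)])² ≤ (C·H_h·(L^{−γ∕2})^K·e^{−δ|b−b′|})²·N^{−(d+1)}Σ_yλ(y)²` — Schur's test (part Ξ-a) on part S-e's rate
profile with decay (§1 row sums `≤ Aθ^K`), the pair operator read as a kernel operator on `λ∘π` (P″ `sum_comp_underPtN`, `inv_mulVec_eq_sum`), and §1
`sum_sq_comp_underPtN`. [cite: Balaban1985BackgroundPropagators, Thm 3.1 (3.46) p.398 (first entry, shape); King1986, Prop. 3.9 (3.73) p.665, Prop. 3.8 (3.71) p.664, (2.17) p.653] -/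
theorem fullPropOp_l2_local_rate (hLodd : Odd L) (hL : 2 ≤ L) {a : ℝ} (ha : 0 < a) {m0sq : ℝ} (hm0 : 0 ≤ m0sq) {γ : ℝ}
    (hγ0 : 0 ≤ γ) (hγ1 : γ ≤ 1) :
    ∃ C δ : ℝ, 0 < C ∧ 0 < δ ∧ ∀ (K : ℕ), 1 ≤ K → ∀ (n : ℕ), 1 ≤ n →
      ∀ (e : ℕ) (M : Fin (d + 1) → ℕ) [∀ μ, NeZero (M μ)], (∀ μ, M μ = 2 * L ^ e) →
      ∀ (msq : ℝ), 0 < msq → msq ≤ m0sq →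
      ∀ (lam : Tor (fine (L ^ K) M) → ℝ) (h : Tor (fine (L ^ n * L ^ K) M) → ℝ) (Hh : ℝ) (b b' : Tor M), 0 ≤ Hh →
        (∀ x', |h x'| ≤ Hh) → (∀ x', h x' ≠ 0 → blockOf (L ^ n * L ^ K) M x' = b) → (∀ y, lam y ≠ 0 → blockOf (L ^ K) M y = b') →
        (((L ^ n * L ^ K : ℕ) : ℝ) ^ (d + 1))⁻¹ * ∑ x', (h x' *
            (((fineOp (L ^ n * L ^ K) M (aK a L (K + n)) (((L ^ n * L ^ K : ℕ) : ℝ) ^ 2) msq)⁻¹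
                *ᵥ (fun y' => lam (underPtN L K n M y'))) x'
              - ((fineOp (L ^ K) M (aK a L K) (((L ^ K : ℕ) : ℝ) ^ 2) msq)⁻¹ *ᵥ lam) (underPtN L K n M x'))) ^ 2
          ≤ (C * Hh * (((L : ℝ) ^ (-(γ / 2))) ^ K) * Real.exp (-(δ * tdistT M b b'))) ^ 2
              * ((((L ^ K : ℕ) : ℝ) ^ (d + 1))⁻¹ * ∑ y, lam y ^ 2) := by
  have hLr : (2 : ℝ) ≤ L := by exact_mod_cast hL
  have hL0 : (0 : ℝ) < L := by linarith
  have hL1 : (1 : ℝ) ≤ L := by linarith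
  obtain ⟨C₀, δ₀, hC₀, hδ₀, HS⟩ := fullProp_rateProfile_decay_unif (d := d) L hLodd hL ha hm0 hγ0 hγ1
  set δ₁ : ℝ := min δ₀ 1 with hδ₁def
  have hδ₁0 : 0 < δ₁ := lt_min hδ₀ one_pos
  set θ : ℝ := (L : ℝ) ^ (-(γ / 2)) with hθdef
  have hθ0 : 0 ≤ θ := Real.rpow_nonneg hL0.le _
  set φ : ℝ := (L : ℝ) ^ (γ / 2) with hφdef
  have hφ0 : 0 ≤ φ := Real.rpow_nonneg hL0.le _
  set Λ : ℝ := (L : ℝ) ^ (d + 1) / (L : ℝ) ^ 2 with hΛdef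
  have hΛ0 : 0 ≤ Λ := by positivity
  set A : ℝ := (4 * ((d : ℝ) + 1) / δ₁) ^ (d + 1) * (1 / (1 - 2⁻¹) + 2) with hAdef
  have hA0 : 0 ≤ A := by positivity
  refine ⟨C₀ * A + 1, δ₀, by positivity, hδ₀, ?_⟩
  intro K hK n hn e M _ hM msq hmsq hcap lam h Hh b b' hHh hh hsh hsl
  -- the ratios of §1: `Λφ ≤ L^{d+1}·½` (`L^{γ∕2−2} ≤ L⁻¹ ≤ ½`), `2Λ ≤ L^{d+1}`, `Λ ≤ L^{d+1}θ` (`L^{−2} ≤ L^{−γ∕2}`)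
  have hLd : (0 : ℝ) < (L : ℝ) ^ (d + 1) := by positivity
  have hL2 : (L : ℝ) ^ 2 = L * L := sq _
  have hΛeq : Λ * (L : ℝ) ^ 2 = (L : ℝ) ^ (d + 1) := by rw [hΛdef]; exact div_mul_cancel₀ _ (pow_ne_zero 2 hL0.ne')
  have hφL : φ ≤ L := by
    calc φ ≤ (L : ℝ) ^ (1 : ℝ) := Real.rpow_le_rpow_of_exponent_le hL1 (by linarith)
      _ = L := Real.rpow_one _
  have hpair : Λ * φ ≤ (L : ℝ) ^ (d + 1) * 2⁻¹ := by
    -- `Λφ ≤ Λ·L = L^{d+1}∕L ≤ L^{d+1}∕2`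
    have h1 : Λ * φ ≤ Λ * L := mul_le_mul_of_nonneg_left hφL hΛ0
    have h2 : Λ * L * 2 ≤ (L : ℝ) ^ (d + 1) := by
      rw [← hΛeq, hL2]
      nlinarith [mul_nonneg (mul_nonneg hΛ0 hL0.le) (sub_nonneg.mpr hLr)]
    linarith
  have hunp2 : 2 * Λ ≤ (L : ℝ) ^ (d + 1) := by
    rw [← hΛeq, hL2]
    have h4 : (2 : ℝ) ≤ L * L := by nlinarith
    nlinarith [mul_nonneg hΛ0 (sub_nonneg.mpr h4)]
  have hunpθ : Λ ≤ (L : ℝ) ^ (d + 1) * θ := by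
    -- `Λ = L^{d+1}·L^{−2}` and `L^{−2} ≤ L^{−γ∕2} = θ`
    have h1 : ((L : ℝ) ^ 2)⁻¹ ≤ θ := by
      rw [hθdef, ← Real.rpow_natCast (L : ℝ) 2, ← Real.rpow_neg hL0.le]
      exact Real.rpow_le_rpow_of_exponent_le hL1 (by push_cast; linarith)
    calc Λ = (L : ℝ) ^ (d + 1) * ((L : ℝ) ^ 2)⁻¹ := by rw [hΛdef, div_eq_mul_inv]
      _ ≤ (L : ℝ) ^ (d + 1) * θ := mul_le_mul_of_nonneg_left h1 hLd.le
  -- the kernel and the profile majorant (at the rate `δ₁`, symmetric)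
  set P : Tor (fine (L ^ n * L ^ K) M) → Tor (fine (L ^ n * L ^ K) M) → ℝ := fun x' y' =>
      θ ^ K * ∑ i ∈ Finset.range K, (Λ * φ) ^ i * Real.exp (-(δ₁ * (tdistT (fine (L ^ n * L ^ K) M) x' y' * (L : ℝ) ^ i / ((L ^ n * L ^ K : ℕ) : ℝ))))
        + ∑ i ∈ Finset.range n, Λ ^ (K + i) * Real.exp (-(δ₁ * (tdistT (fine (L ^ n * L ^ K) M) x' y' * (L : ℝ) ^ (K + i) / ((L ^ n * L ^ K : ℕ) : ℝ))))
    with hPdef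
  have hP0 : ∀ x' y', 0 ≤ P x' y' := fun x' y' => by positivity
  have hPsymm : ∀ x' y', P x' y' = P y' x' := fun x' y' => by simp only [hPdef, tdistT_symm (fine (L ^ n * L ^ K) M) x' y']
  set k : Tor (fine (L ^ n * L ^ K) M) → Tor (fine (L ^ n * L ^ K) M) → ℝ := fun x' y' =>
      constrainedProp (L ^ n * L ^ K) M (aK a L (K + n)) (((L ^ n * L ^ K : ℕ) : ℝ) ^ 2) msq x' y'
        - constrainedProp (L ^ K) M (aK a L K) (((L ^ K : ℕ) : ℝ) ^ 2) msq (underPtN L K n M x') (underPtN L K n M y') with hkdef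
  have hk : ∀ x' y', |k x' y'| ≤ C₀ * P x' y' * Real.exp (-(δ₀ * tdistT M (blockOf (L ^ n * L ^ K) M x') (blockOf (L ^ n * L ^ K) M y'))) := by
    intro x' y'
    have h := HS K hK n hn e M hM msq hmsq hcap x' y'
    rw [blockOf_underPtN, blockOf_underPtN] at h
    refine h.trans (mul_le_mul_of_nonneg_right (mul_le_mul_of_nonneg_left ?_ hC₀.le) (Real.exp_pos _).le)
    have hmono : ∀ s : ℝ, 0 ≤ s → Real.exp (-(δ₀ * (tdistT (fine (L ^ n * L ^ K) M) x' y' * s / ((L ^ n * L ^ K : ℕ) : ℝ))))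
        ≤ Real.exp (-(δ₁ * (tdistT (fine (L ^ n * L ^ K) M) x' y' * s / ((L ^ n * L ^ K : ℕ) : ℝ)))) := fun s hs => by
      apply Real.exp_le_exp.mpr
      have h0 : 0 ≤ tdistT (fine (L ^ n * L ^ K) M) x' y' * s / ((L ^ n * L ^ K : ℕ) : ℝ) := by have := tdistT_nonneg (fine (L ^ n * L ^ K) M) x' y'; positivity
      nlinarith [mul_le_mul_of_nonneg_right (min_le_left δ₀ 1) h0]
    have hΛφ : (L : ℝ) ^ (d + 1) / (L : ℝ) ^ 2 * (L : ℝ) ^ (γ / 2) = Λ * φ := by rw [hΛdef, hφdef]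
    rw [hPdef, hΛφ]
    refine add_le_add (mul_le_mul_of_nonneg_left (Finset.sum_le_sum fun i _ => mul_le_mul_of_nonneg_left (hmono _ (by positivity))
      (by positivity)) (by positivity)) (Finset.sum_le_sum fun i _ => mul_le_mul_of_nonneg_left (hmono _ (by positivity)) (by positivity))
  have hrow : ∀ x', ∑ y', (((L ^ n * L ^ K : ℕ) : ℝ) ^ (d + 1))⁻¹ * P x' y' ≤ A * θ ^ K := fun x' =>
    rateProfile_fineSum_le L hL (L ^ n * L ^ K) rfl M hδ₁0 (min_le_right _ _) hΛ0 hφ0 hθ0 (by norm_num) (by norm_num) hpair hunp2 hunpθ x'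
  have hcol : ∀ y', ∑ x', (((L ^ n * L ^ K : ℕ) : ℝ) ^ (d + 1))⁻¹ * P x' y' ≤ A * θ ^ K := fun y' => by
    rw [Finset.sum_congr rfl fun x' _ => by rw [hPsymm x' y']]
    exact rateProfile_fineSum_le L hL (L ^ n * L ^ K) rfl M hδ₁0 (min_le_right _ _) hΛ0 hφ0 hθ0 (by norm_num) (by norm_num) hpair hunp2 hunpθ y'
  -- supports on the η′-lattice
  have hsl' : ∀ y' : Tor (fine (L ^ n * L ^ K) M), lam (underPtN L K n M y') ≠ 0 → blockOf (L ^ n * L ^ K) M y' = b' := fun y' hy' => by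
    rw [← blockOf_underPtN]; exact hsl _ hy'
  -- Schur
  have hS := l2_local_of_kernel_bound (L ^ n * L ^ K) M k P hC₀.le (by positivity : 0 ≤ A * θ ^ K) hP0 hk hrow hcol
    (fun y' => lam (underPtN L K n M y')) h b b' hHh hh hsh hsl'
  -- the pair operator as the kernel operator on `λ∘π`
  have hrepr : ∀ x', ((fineOp (L ^ n * L ^ K) M (aK a L (K + n)) (((L ^ n * L ^ K : ℕ) : ℝ) ^ 2) msq)⁻¹ *ᵥ (fun y' => lam (underPtN L K n M y'))) x'
        - ((fineOp (L ^ K) M (aK a L K) (((L ^ K : ℕ) : ℝ) ^ 2) msq)⁻¹ *ᵥ lam) (underPtN L K n M x')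
      = ∑ y', (((L ^ n * L ^ K : ℕ) : ℝ) ^ (d + 1))⁻¹ * k x' y' * lam (underPtN L K n M y') := by
    intro x'
    rw [inv_mulVec_eq_sum, inv_mulVec_eq_sum]
    have hc : ∑ y : Tor (fine (L ^ K) M), (((L ^ K : ℕ) : ℝ) ^ (d + 1))⁻¹
          * constrainedProp (L ^ K) M (aK a L K) (((L ^ K : ℕ) : ℝ) ^ 2) msq (underPtN L K n M x') y * lam y
        = ∑ y', (((L ^ n * L ^ K : ℕ) : ℝ) ^ (d + 1))⁻¹
          * constrainedProp (L ^ K) M (aK a L K) (((L ^ K : ℕ) : ℝ) ^ 2) msq (underPtN L K n M x') (underPtN L K n M y')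
            * lam (underPtN L K n M y') := by
      have hsc := sum_comp_underPtN L K n M
        (fun y => constrainedProp (L ^ K) M (aK a L K) (((L ^ K : ℕ) : ℝ) ^ 2) msq (underPtN L K n M x') y * lam y)
      have hcc : (((L ^ n * L ^ K : ℕ) : ℝ) ^ (d + 1))⁻¹ * (((L ^ n : ℕ) : ℝ) ^ (d + 1)) = (((L ^ K : ℕ) : ℝ) ^ (d + 1))⁻¹ := by
        push_cast
        have h1 : ((L : ℝ) ^ n) ^ (d + 1) ≠ 0 := by positivity
        have h2 : ((L : ℝ) ^ K) ^ (d + 1) ≠ 0 := by positivity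
        field_simp
        ring
      symm
      rw [Finset.sum_congr rfl fun y' _ => (mul_assoc _ _ _), ← Finset.mul_sum, hsc, ← mul_assoc, hcc, Finset.mul_sum]
      exact Finset.sum_congr rfl fun y _ => (mul_assoc _ _ _).symm
    rw [hc, ← Finset.sum_sub_distrib]
    exact Finset.sum_congr rfl fun y' _ => by rw [hkdef]; ring
  rw [Finset.sum_congr rfl fun x' _ => by rw [hrepr x']]
  -- assemble: Schur bound × the weight, `N′^{−(d+1)}Σ(λ∘π)² = N^{−(d+1)}Σλ²`
  have hw0 : 0 ≤ (((L ^ n * L ^ K : ℕ) : ℝ) ^ (d + 1))⁻¹ := by positivity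
  have hnorm := sum_sq_comp_underPtN L K n M lam
  calc (((L ^ n * L ^ K : ℕ) : ℝ) ^ (d + 1))⁻¹ * ∑ x', (h x' * ∑ y', (((L ^ n * L ^ K : ℕ) : ℝ) ^ (d + 1))⁻¹ * k x' y' * lam (underPtN L K n M y')) ^ 2
      ≤ (((L ^ n * L ^ K : ℕ) : ℝ) ^ (d + 1))⁻¹ * ((C₀ * (A * θ ^ K) * Hh * Real.exp (-(δ₀ * tdistT M b b'))) ^ 2
          * ∑ y', lam (underPtN L K n M y') ^ 2) := mul_le_mul_of_nonneg_left hS hw0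
    _ = (C₀ * A * Hh * θ ^ K * Real.exp (-(δ₀ * tdistT M b b'))) ^ 2
          * ((((L ^ n * L ^ K : ℕ) : ℝ) ^ (d + 1))⁻¹ * ∑ y', lam (underPtN L K n M y') ^ 2) := by ring
    _ = (C₀ * A * Hh * θ ^ K * Real.exp (-(δ₀ * tdistT M b b'))) ^ 2 * ((((L ^ K : ℕ) : ℝ) ^ (d + 1))⁻¹ * ∑ y, lam y ^ 2) := by
        rw [hnorm]
    _ ≤ ((C₀ * A + 1) * Hh * θ ^ K * Real.exp (-(δ₀ * tdistT M b b'))) ^ 2 * ((((L ^ K : ℕ) : ℝ) ^ (d + 1))⁻¹ * ∑ y, lam y ^ 2) := by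
        refine mul_le_mul_of_nonneg_right (pow_le_pow_left₀ (by positivity) ?_ 2)
          (mul_nonneg (by positivity) (Finset.sum_nonneg fun y _ => sq_nonneg _))
        have : 0 ≤ Hh * θ ^ K * Real.exp (-(δ₀ * tdistT M b b')) := by positivity
        nlinarith

end Summit.QuantumFields.YangMills.BalabanUVNodes.N15KingModelRung.Curved
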